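import Mathlib
import HarnessLib
import Summits.HubbardSuperconductivity.HubbardSuperconductivity.Theorems.KLProgrammeKLRegimeEngineV8E5PointAugmentOverlapModel
import Summits.HubbardSuperconductivity.HubbardSuperconductivity.Theorems.KLProgrammeKLRegimeOverlapWtColFlowDeep

/-!
# Route `KLProgramme` — ENGINE child gen 8 (stmt-HubbardSuperconductivity-20437 `KLRegimeEngineV17F2`), SKELETON v2 class #3, (RA-U) SUPPLIER part 4,
# input 3 DISCHARGED on the flow frame: the point-augmented overlap rows `(cr⁺, cc⁺)` at `K_n` from p3's (L2) overlap data
# (cell gate-hubbard-kl, seat p5 g14; memo HOME/prover-p5/g11/RA-U-SUPPLY-g11.md §7.3 item 3; companion of `…E5PointAugmentOverlap(Model)`)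

The PLAIN overlap rows of `E(klAnisoFamily J′)·S(bgmFatMultiplier k)` on the flow frame `K_n = klFlowFrameU … n` are p3's weighted ones with the weight
dropped (`1 ≤ klScaleWt`, `one_le_klScaleWt`): rows `≤ 81·C_J·M/β` (`overlapWt_jump_sums_klEng_flow_deep`, p585156) and full columns `≤ 81·2^{J′−k}·C_J·M/β`
(`overlapWt_colSum_klEng_flow_deep`, p590305), both under p3's binders (doors `klEngC₃6`, `klEngU₀3 ∧ 1/(Gfr₃+1)`, `klEngL₃`, `klEngM₃`, `HistP klPredsV17F2 … 0 n`,
`FrameOK … K_n`) in the deep window `4ⁿ·U ≤ 4^{2(k+1)+d′}` — automatic with `d′ = 6` for the supplier's levels `k ≥ n − 4` since `U ≤ 1`.  Feeding them to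
`overlapRows_pointAugment_klAniso_bgmFat` (`(imagTimeWeight β M)⁻¹ = 2M/β`):

* **`overlapRows_pointAugment_klEng_flow`** — ONE absolute `C_J > 0`: under p3's binders, for `1 ≤ k`, `k + 1 ≤ J′ ≤ n ≤ k + 4` and ANY point momenta
  `e : Fin q → FreqMomentum`, the augmented pair `(pointAugment (klAnisoFamily J′) e, pointAugmentFat (klAnisoFamily k) (bgmFatMultiplier k) e)` at `K_n` has
  `hrow′` with **`cr⁺ = (81·C_J + 2(9 + q))·M/β`** and `hcol′` with **`cc⁺ = (81·2^{J′−k}·C_J + 2(1 + q))·M/β`**;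
* **`overlapRows_pointAugment_klEng_e5`** — the three instances the carrier doors read (…E5CarrierDoors §1–§3; `q = 4`, `e = klE5ExtMomenta Qm x y`):
  `(J′, k) = (n−2, n−3)` [terms 2 and 4], `(n−2, n−4)` and `(n−3, n−4)` [term 3 at `J′ = n−2` and its re-read at `J′ = n−3`]:
  `cr⁺ = (81·C_J + 26)·M/β`, `cc⁺ ≤ (324·C_J + 10)·M/β` (jump `≤ 2`).

So item 3 of the supplier's part 4 is SUPPLIED BY NAME modulo p3's binders (⊆ the stub binders of class #3 up to the `HistP`/`FrameOK` rows, which the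
class-#3 closer holds).  Everything is proved; no definitions; no named facts; nothing about the model's sizes beyond the cited overlap data is asserted;
nothing asserts superconductivity. [cite: BenfattoGiulianiMastropietro2006, §2.7 (2.71a), §2.8 (2.77)]
-/

noncomputable section

namespace Summit.HubbardSuperconductivity.HubbardSuperconductivity.Theorems.KLRegimeSplit

set_option linter.dupNamespace false -- summit = problem name (single-conjunct summit), D-0017

open Real Finset Literature.MathematicalPhysics.QuantumLattice Literature.Probability.LatticeModels Matrix
open Literature.MathematicalPhysics.QuantumLattice.FermiRG
open Summit.HubbardSuperconductivity.HubbardSuperconductivity.Theorems.KLProgrammeLegKernels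
open Summit.HubbardSuperconductivity.HubbardSuperconductivity.Theorems.KLRegimeWick
open Summit.HubbardSuperconductivity.HubbardSuperconductivity.Theorems.TorusFourierL2
open Summit.HubbardSuperconductivity.HubbardSuperconductivity.Theorems.DispersionFlow
open Summit.HubbardSuperconductivity.HubbardSuperconductivity.Theorems.EngineV8

/-! ## §1 The plain rows on the flow frame and the augmented rows, one absolute constant -/

/-- `(imagTimeWeight β M)⁻¹ = 2M/β`. [folklore] -/
theorem inv_imagTimeWeight_eq (β : ℝ) (M : ℕ) : (imagTimeWeight β M)⁻¹ = 2 * (M : ℝ) / β := by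
  unfold imagTimeWeight
  rw [inv_div]

/-- **THE POINT-AUGMENTED OVERLAP ROWS ON THE FLOW FRAME, DISCHARGED** (see the module docstring): one absolute `C_J > 0` such that under p3's (L2) binders,
for `1 ≤ k`, `k + 1 ≤ J′ ≤ n ≤ k + 4` and any point momenta `e`, `hrow′` holds with `(81·C_J + 2(9+q))·M/β` and `hcol′` with `(81·2^{J′−k}·C_J + 2(1+q))·M/β`.
[cite: BenfattoGiulianiMastropietro2006, §2.7 (2.71a), §2.8 (2.77)] -/
theorem overlapRows_pointAugment_klEng_flow :
    ∃ CJ : ℝ, 0 < CJ ∧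
      ∀ (G : GeoConsts) (P : SplitConsts) (R : RenConsts) (Q : EngConsts) (cc : ℝ), R.WF2 → 0 < cc → cc ≤ klEngC₃6 P R →
      ∀ μ ∈ klWindowC, ∀ U : ℝ, 0 < U → U ≤ min (klEngU₀3 P R cc) (1 / (R.Gfr 3 + 1)) →
      ∀ β : ℝ, klBetaMin ≤ β → β ≤ Real.exp (cc / U ^ 2) →
      ∀ (L M : ℕ) [NeZero L] [NeZero M], klEngL₃ β U ≤ L → klEngM₃ β U L ≤ M →
      ∀ n : ℕ, 1 ≤ n → n ≤ nScales β + 1 →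
        HistP klPredsV17F2 L M G P Q R β U μ 0 n → FrameOK R U (nScales β) μ (klFlowFrameU L M β U μ n) →
        ∀ k J' : ℕ, 1 ≤ k → k + 1 ≤ J' → J' ≤ n → n ≤ k + 4 → ∀ {q : ℕ} (e : Fin q → FreqMomentum L M),
        (∀ X'' : SpaceTimeIdx L M × SectorLeg (sectorCount J' + q), ∑ X' : SpaceTimeIdx L M × SectorLeg (sectorCount k + q),
          ‖(sectorAnalysisMatrix L M β (pointAugment (klAnisoFamily L M β μ (klFlowFrameU L M β U μ n) klE0 J') e) *
            sectorSubMatrix L M β (pointAugmentFat (klAnisoFamily L M β μ (klFlowFrameU L M β U μ n) klE0 k)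
              (bgmFatMultiplier L M klE0 β (nambuXiCT L μ (klFlowFrameU L M β U μ n)) k) e)) X'' X'‖ ≤
          (81 * CJ + 2 * (9 + q)) * M / β) ∧
        (∀ X' : SpaceTimeIdx L M × SectorLeg (sectorCount k + q), ∑ X'' : SpaceTimeIdx L M × SectorLeg (sectorCount J' + q),
          ‖(sectorAnalysisMatrix L M β (pointAugment (klAnisoFamily L M β μ (klFlowFrameU L M β U μ n) klE0 J') e) *
            sectorSubMatrix L M β (pointAugmentFat (klAnisoFamily L M β μ (klFlowFrameU L M β U μ n) klE0 k)
              (bgmFatMultiplier L M klE0 β (nambuXiCT L μ (klFlowFrameU L M β U μ n)) k) e)) X'' X'‖ ≤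
          (81 * (2 : ℝ) ^ (J' - k) * CJ + 2 * (1 + q)) * M / β) := by
  obtain ⟨C₁, hC₁, hrow⟩ := overlapWt_jump_sums_klEng_flow_deep 6
  obtain ⟨C₂, hC₂, hcol⟩ := overlapWt_colSum_klEng_flow_deep 6
  refine ⟨max C₁ C₂, lt_max_of_lt_left hC₁, ?_⟩
  intro G P R Q cc hR2 hcc hcc6 μ hμ U hU hUle β hβmin hβc L M _ _ hL3 hM3 n hn1 hnN hhist hfr k J' hk hkJ hJn hnk q e
  have hβ0 : 0 < β := pos_of_klBetaMin_le hβmin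
  have hM0 : (0 : ℝ) ≤ M := Nat.cast_nonneg _
  have hMβ : 0 ≤ (M : ℝ) / β := div_nonneg hM0 hβ0.le
  -- the deep window `4ⁿ·U ≤ 4^{2(k+1)+6}` from `U ≤ 1/(Gfr₃+1) ≤ 1` and `n ≤ 2(k+1)+6`
  have hU1 : U ≤ 1 := by
    have hG : 0 ≤ R.Gfr 3 := gfr_nonneg_of_wf2 hR2 3
    calc U ≤ 1 / (R.Gfr 3 + 1) := hUle.trans (min_le_right _ _)
      _ ≤ 1 := by rw [div_le_one (by linarith)]; linarith
  have hnd : (4 : ℝ) ^ n * U ≤ (4 : ℝ) ^ (2 * (k + 1) + 6) :=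
    calc (4 : ℝ) ^ n * U ≤ (4 : ℝ) ^ n * 1 := mul_le_mul_of_nonneg_left hU1 (pow_nonneg (by norm_num) n)
      _ ≤ (4 : ℝ) ^ (2 * (k + 1) + 6) := by rw [mul_one]; exact pow_le_pow_right₀ (by norm_num) (by omega)
  -- p3's weighted rows and columns, weight dropped
  obtain ⟨hr, -, -⟩ := hrow G P R Q cc hR2 hcc hcc6 μ hμ U hU hUle β hβmin hβc L M hL3 hM3 n hn1 hnN hhist hfr k J' hkJ hJn hnd
  have hc := hcol G P R Q cc hR2 hcc hcc6 μ hμ U hU hUle β hβmin hβc L M hL3 hM3 n hn1 hnN hhist hfr k J' hkJ hJn hnd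
  set K := klFlowFrameU L M β U μ n with hK
  have hcr : ∀ Y'' : SpaceTimeIdx L M × SectorLeg (sectorCount J'), ∑ Y' : SpaceTimeIdx L M × SectorLeg (sectorCount k),
      ‖(sectorAnalysisMatrix L M β (klAnisoFamily L M β μ K klE0 J') * sectorSubMatrix L M β (bgmFatMultiplier L M klE0 β (nambuXiCT L μ K) k)) Y'' Y'‖ ≤
        81 * max C₁ C₂ * M / β := by
    intro Y''
    calc _ ≤ ∑ Y' : SpaceTimeIdx L M × SectorLeg (sectorCount k),
          ‖(sectorAnalysisMatrix L M β (klAnisoFamily L M β μ K klE0 J') * sectorSubMatrix L M β (bgmFatMultiplier L M klE0 β (nambuXiCT L μ K) k)) Y'' Y'‖ *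
            klScaleWt L M β J' {latticeLegPos (2 * (2 * M)) Y'', latticeLegPos (2 * (2 * M)) Y'} :=
          sum_le_sum fun Y' _ => le_mul_of_one_le_right (norm_nonneg _) (one_le_klScaleWt L M β J' _)
      _ ≤ 81 * C₁ * M / β := hr Y''
      _ ≤ 81 * max C₁ C₂ * M / β := by
          have : 81 * C₁ * (M / β) ≤ 81 * max C₁ C₂ * (M / β) := mul_le_mul_of_nonneg_right (by linarith [le_max_left C₁ C₂]) hMβ
          calc 81 * C₁ * ↑M / β = 81 * C₁ * (M / β) := by ring
            _ ≤ 81 * max C₁ C₂ * (M / β) := this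
            _ = _ := by ring
  have hcc' : ∀ Y' : SpaceTimeIdx L M × SectorLeg (sectorCount k), ∑ Y'' : SpaceTimeIdx L M × SectorLeg (sectorCount J'),
      ‖(sectorAnalysisMatrix L M β (klAnisoFamily L M β μ K klE0 J') * sectorSubMatrix L M β (bgmFatMultiplier L M klE0 β (nambuXiCT L μ K) k)) Y'' Y'‖ ≤
        81 * (2 : ℝ) ^ (J' - k) * max C₁ C₂ * M / β := by
    intro Y'
    calc _ ≤ ∑ Y'' : SpaceTimeIdx L M × SectorLeg (sectorCount J'),
          ‖(sectorAnalysisMatrix L M β (klAnisoFamily L M β μ K klE0 J') * sectorSubMatrix L M β (bgmFatMultiplier L M klE0 β (nambuXiCT L μ K) k)) Y'' Y'‖ *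
            klScaleWt L M β J' {latticeLegPos (2 * (2 * M)) Y'', latticeLegPos (2 * (2 * M)) Y'} :=
          sum_le_sum fun Y'' _ => le_mul_of_one_le_right (norm_nonneg _) (one_le_klScaleWt L M β J' _)
      _ ≤ 81 * (2 : ℝ) ^ (J' - k) * C₂ * M / β := hc Y'
      _ ≤ 81 * (2 : ℝ) ^ (J' - k) * max C₁ C₂ * M / β := by
          have h2 : (0 : ℝ) ≤ 81 * (2 : ℝ) ^ (J' - k) := by positivity
          have : 81 * (2 : ℝ) ^ (J' - k) * C₂ * (M / β) ≤ 81 * (2 : ℝ) ^ (J' - k) * max C₁ C₂ * (M / β) :=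
            mul_le_mul_of_nonneg_right (mul_le_mul_of_nonneg_left (le_max_right C₁ C₂) h2) hMβ
          calc 81 * (2 : ℝ) ^ (J' - k) * C₂ * ↑M / β = 81 * (2 : ℝ) ^ (J' - k) * C₂ * (M / β) := by ring
            _ ≤ 81 * (2 : ℝ) ^ (J' - k) * max C₁ C₂ * (M / β) := this
            _ = _ := by ring
  have hcr0 : 0 ≤ 81 * max C₁ C₂ * M / β := by
    have : 0 ≤ max C₁ C₂ := hC₁.le.trans (le_max_left _ _)
    positivity
  have hcc0 : 0 ≤ 81 * (2 : ℝ) ^ (J' - k) * max C₁ C₂ * M / β := by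
    have : 0 ≤ max C₁ C₂ := hC₁.le.trans (le_max_left _ _)
    positivity
  obtain ⟨h1, h2⟩ := overlapRows_pointAugment_klAniso_bgmFat (L := L) (M := M) hβ0 μ K J' hk e hcr0 hcc0 hcr hcc'
  have hε : (imagTimeWeight β M)⁻¹ = 2 * (M : ℝ) / β := inv_imagTimeWeight_eq β M
  refine ⟨fun X'' => (h1 X'').trans (le_of_eq ?_), fun X' => (h2 X').trans (le_of_eq ?_)⟩
  · rw [hε]; ring
  · rw [hε]; ring

/-! ## §2 The three instances read by the carrier doors (`q = 4`, `e = klE5ExtMomenta Qm x y`) -/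

/-- **THE `(cr⁺, cc⁺)` OF THE (RA-U) COMPOSITION** (memo RA-U-SUPPLY-g11 §7.2): under p3's binders and `4 ≤ n` (resp. `5 ≤ n` for the level-`n−4` input
family), for all pair labels `(Qm; x, y)`, the augmented pairs at `(J′, k) = (n−2, n−3)`, `(n−2, n−4)`, `(n−3, n−4)` satisfy `hrow′` with
`cr⁺ := (81·C_J + 26)·M/β` and `hcol′` with `cc⁺ := (324·C_J + 10)·M/β` (one pair of constants for all three; jump `J′ − k ≤ 2`).
[cite: BenfattoGiulianiMastropietro2006, §2.7 (2.71a), §2.8 (2.77)] -/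
theorem overlapRows_pointAugment_klEng_e5 :
    ∃ CJ : ℝ, 0 < CJ ∧
      ∀ (G : GeoConsts) (P : SplitConsts) (R : RenConsts) (Q : EngConsts) (cc : ℝ), R.WF2 → 0 < cc → cc ≤ klEngC₃6 P R →
      ∀ μ ∈ klWindowC, ∀ U : ℝ, 0 < U → U ≤ min (klEngU₀3 P R cc) (1 / (R.Gfr 3 + 1)) →
      ∀ β : ℝ, klBetaMin ≤ β → β ≤ Real.exp (cc / U ^ 2) →
      ∀ (L M : ℕ) [NeZero L] [NeZero M], klEngL₃ β U ≤ L → klEngM₃ β U L ≤ M →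
      ∀ n : ℕ, n ≤ nScales β + 1 →
        HistP klPredsV17F2 L M G P Q R β U μ 0 n → FrameOK R U (nScales β) μ (klFlowFrameU L M β U μ n) →
        ∀ (Qm : TorusSite 2 L) (x y : TorusSite 2 L × MatsubaraIdx M) (J' k : ℕ),
        (4 ≤ n ∧ J' = n - 2 ∧ k = n - 3) ∨ (5 ≤ n ∧ J' = n - 2 ∧ k = n - 4) ∨ (5 ≤ n ∧ J' = n - 3 ∧ k = n - 4) →
        (∀ X'' : SpaceTimeIdx L M × SectorLeg (sectorCount J' + 4), ∑ X' : SpaceTimeIdx L M × SectorLeg (sectorCount k + 4),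
          ‖(sectorAnalysisMatrix L M β (pointAugment (klAnisoFamily L M β μ (klFlowFrameU L M β U μ n) klE0 J') (klE5ExtMomenta Qm x y)) *
            sectorSubMatrix L M β (pointAugmentFat (klAnisoFamily L M β μ (klFlowFrameU L M β U μ n) klE0 k)
              (bgmFatMultiplier L M klE0 β (nambuXiCT L μ (klFlowFrameU L M β U μ n)) k) (klE5ExtMomenta Qm x y))) X'' X'‖ ≤
          (81 * CJ + 26) * M / β) ∧
        (∀ X' : SpaceTimeIdx L M × SectorLeg (sectorCount k + 4), ∑ X'' : SpaceTimeIdx L M × SectorLeg (sectorCount J' + 4),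
          ‖(sectorAnalysisMatrix L M β (pointAugment (klAnisoFamily L M β μ (klFlowFrameU L M β U μ n) klE0 J') (klE5ExtMomenta Qm x y)) *
            sectorSubMatrix L M β (pointAugmentFat (klAnisoFamily L M β μ (klFlowFrameU L M β U μ n) klE0 k)
              (bgmFatMultiplier L M klE0 β (nambuXiCT L μ (klFlowFrameU L M β U μ n)) k) (klE5ExtMomenta Qm x y))) X'' X'‖ ≤
          (324 * CJ + 10) * M / β) := by
  obtain ⟨CJ, hCJ, h⟩ := overlapRows_pointAugment_klEng_flow
  refine ⟨CJ, hCJ, ?_⟩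
  intro G P R Q cc hR2 hcc hcc6 μ hμ U hU hUle β hβmin hβc L M _ _ hL3 hM3 n hnN hhist hfr Qm x y J' k hcase
  have hβ0 : 0 < β := pos_of_klBetaMin_le hβmin
  have hM0 : (0 : ℝ) ≤ M := Nat.cast_nonneg _
  have hMβ : 0 ≤ (M : ℝ) / β := div_nonneg hM0 hβ0.le
  have hn1 : 1 ≤ n := by rcases hcase with ⟨h4, -, -⟩ | ⟨h5, -, -⟩ | ⟨h5, -, -⟩ <;> omega
  have hk : 1 ≤ k := by rcases hcase with ⟨h4, -, rfl⟩ | ⟨h5, -, rfl⟩ | ⟨h5, -, rfl⟩ <;> omega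
  have hkJ : k + 1 ≤ J' := by rcases hcase with ⟨h4, rfl, rfl⟩ | ⟨h5, rfl, rfl⟩ | ⟨h5, rfl, rfl⟩ <;> omega
  have hJn : J' ≤ n := by rcases hcase with ⟨h4, rfl, -⟩ | ⟨h5, rfl, -⟩ | ⟨h5, rfl, -⟩ <;> omega
  have hnk : n ≤ k + 4 := by rcases hcase with ⟨h4, -, rfl⟩ | ⟨h5, -, rfl⟩ | ⟨h5, -, rfl⟩ <;> omega
  have hjump : J' - k ≤ 2 := by rcases hcase with ⟨h4, rfl, rfl⟩ | ⟨h5, rfl, rfl⟩ | ⟨h5, rfl, rfl⟩ <;> omega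
  obtain ⟨h1, h2⟩ := h G P R Q cc hR2 hcc hcc6 μ hμ U hU hUle β hβmin hβc L M hL3 hM3 n hn1 hnN hhist hfr k J' hk hkJ hJn hnk (klE5ExtMomenta Qm x y)
  refine ⟨fun X'' => (h1 X'').trans (le_of_eq ?_), fun X' => (h2 X').trans ?_⟩
  · push_cast; ring
  · have hpow : (2 : ℝ) ^ (J' - k) ≤ 4 := by
      calc (2 : ℝ) ^ (J' - k) ≤ (2 : ℝ) ^ 2 := pow_le_pow_right₀ (by norm_num) hjump
        _ = 4 := by norm_num
    have hnum : 81 * (2 : ℝ) ^ (J' - k) * CJ + 2 * (1 + ((4 : ℕ) : ℝ)) ≤ 324 * CJ + 10 := by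
      push_cast
      nlinarith [hCJ, hpow]
    calc (81 * (2 : ℝ) ^ (J' - k) * CJ + 2 * (1 + ((4 : ℕ) : ℝ))) * ↑M / β
        = (81 * (2 : ℝ) ^ (J' - k) * CJ + 2 * (1 + ((4 : ℕ) : ℝ))) * (M / β) := by ring
      _ ≤ (324 * CJ + 10) * (M / β) := mul_le_mul_of_nonneg_right hnum hMβ
      _ = _ := by ring

end Summit.HubbardSuperconductivity.HubbardSuperconductivity.Theorems.KLRegimeSplit

end
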